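import Literature.NumberTheory.Rogawski1990.TransferFactsCanonical              -- ★ `OrbitalMeasureFamily.IsQuotientOf` (Weil form for GIVEN torus measures)
import Literature.NumberTheory.Rogawski1990.LocalTransferRescale                 -- ★ `classOrbitalIntegral_smul_measure_eq_mul`, `IsInnerTransferRel.pi_smul` (the GLOBAL-weight form)
import Literature.NumberTheory.Automorphic.UnitaryGroupDiagTraceExplicitWeights  -- ★ `Literature.MeasureTheory.Group.quotientMeasure_eq_inv_smul_of_eq_smul` (`dν ∕ d(c·t) = c⁻¹ · dν ∕ dt`)
import HarnessLib

/-!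
# Two Weil-form families for the SAME Haar measure differ class by class by the Haar ratio of their torus measures; the ratio is transported
# by any measure isomorphism of the tori; (14.2.1) survives class-by-class weights given ONLY on the classes it reads
(Rogawski, *Automorphic Representations of Unitary Groups in Three Variables* (1990), §1.7 p. 6 «compatible measures», §4.3 (4.3.1) p. 43,
§14.2 (14.2.1) pp. 232–233; Deitmar–Echterhoff (2014), Thm. 1.5.3)

Topic `NumberTheory/Rogawski1990`; namespaces `Literature.NumberTheory.Automorphic` (§0–§1, generic groups) and `Literature.NumberTheory.Rogawski1990`
(§2, the abstract relations of ★ `LocalTransfer` §1 ∕ ★ `ArchimedeanTransfer` §0).  THEOREMS ONLY (no definition, no instance, no named fact, no notation, no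
`sorry`).  Cell `pub/hodgecm-mathlib`, half-A line LH2 (closer stub `stub_N8` = ★ `ArchInnerTransferCompatible` of `Cruxes/H413/Lines/F0_U3LettersRung1.lean`,
crux H413 = `stmt-HodgeConjecture-24833`); author LH2-p02 (g0); the GENERIC half of the planner's organ (Σ) «system-change invariance» (LH2-plan PRE-DEAL
2026-09-02T01:58:53Z), assembled on the archimedean carriers by LH2-p01.

WHY.  ★ `ArchInnerTransferCompatible L H′ ν′ ν` states the archimedean inner-form transfer (14.2.1) FOR EVERY system `(m′, m, t′, t)` in Weil form for the
given Haar measures `ν′, ν` with transport-compatible torus measures (★ `ArchCompatibleFamiliesG`), whereas print ([Rogawski1990, §14.2 p. 233] after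
[Shelstad1979, Thm. 4.1]) gives it for ONE such system.  The letter's own docstring records why the two agree: «two systems both satisfying (C′)(C)(C′G)
differ class by class by positive constants `t_γ = c(γ)·(t₀)_γ` (two Haar measures on the torus `Z(γ)`) with `c` constant on stable classes and equal on
corresponding classes across the twist; the Weil-form orbital integrals then scale by `c(γ)⁻¹` on BOTH sides of (14.2.1)».  This file is that sentence,
kernel-checked, in three generic pieces:

* §0 (bookkeeping on a locally compact group `Z`) `nnreal_eq_of_smul_eq_smul_of_isHaarMeasure` — a Haar measure is cancellable: `κ₁ • μ = κ₂ • μ ⇒ κ₁ = κ₂`;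
  **`nnreal_eq_of_map_eq_of_eq_smul`** — THE RATIO IS TRANSPORTED: if a map `e : Z₁ → Z₂` pushes `s₁ ↦ s₂` and `t₁ ↦ t₂`, `tᵢ = κᵢ • sᵢ` and `s₂` is a
  Haar measure, then `κ₁ = κ₂` (the shape of (C), (C′), (C′G) with `e = ★ archStableCentralizerEquiv …`).
* §1 (`G` locally compact, second countable, Hausdorff; Borel σ-algebras on the orbit quotients as section hypotheses)
  **`OrbitalMeasureFamily.IsQuotientOf.exists_eq_nnreal_smul`** — if `m = dν ∕ dt` and `m₀ = dν ∕ dt₀` on the `P`-classes (★ `IsQuotientOf`, SAME `ν`), then at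
  every `P`-class `c` there is `κ > 0` (the Haar scalar factor of `t (out c)` against `t₀ (out c)` on the closed subgroup `Z(out c)`) with
  `t (out c) = κ • t₀ (out c)` and `m c = κ⁻¹ • m₀ c` (Mathlib `isMulLeftInvariant_eq_smul` + ★ `quotientMeasure_eq_inv_smul_of_eq_smul`); and
  `…exists_eq_smul` — the same with an `ℝ≥0∞` weight `≠ 0, ⊤` on `m`.
* §2 (abstract groups `A`, `B`; ALL relations PARAMETERS, so it applies verbatim to the `abbrev`s ★ `IsArchInnerTransfer` ∕ ★ `IsLocalInnerTransfer`)
  `stableOrbitalIntegralRel_congr_measure` (`Φ^st_m(γ, f)` reads `m` only at the classes `c` with `st γ (out c)`), **`stableOrbitalIntegralRel_eq_mul_of_forall_eq_smul`**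
  (`m c = κ • m₀ c` on those classes ⇒ `Φ^st_m(γ, f) = κ.toReal · Φ^st_{m₀}(γ, f)` — the LOCAL form of ★ `stableOrbitalIntegralRel_pi_smul_of_const`: no global
  weight function, nothing asked at the other classes, which is all (W′)(W) provide), **`IsInnerTransferRel.of_forall_eq_smul`** ((14.2.1) for `(m′₀, m₀)` and,
  for every regular `γ`, ONE weight `κ` with `m = κ • m₀` on the stable class of `γ` and `m′ = κ • m′₀` on the stable class of every `γ′ ↔ γ` ⇒ (14.2.1) for
  `(m′, m)`, same functions) and its ∃-form **`IsInnerTransferExistsRel.of_forall_eq_smul`** (same partner `f`, same classes).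
* §3 (ED. 2, append-only; abstract TOPOLOGICAL groups `A`, `B`, transport maps as FUNCTION-valued parameters) **`exists_weight_of_isQuotientOf_of_transport`** —
  the hypothesis `hκ` of §2 DERIVED from two Weil-form systems for the same Haar measures whose torus measures are transported along the SAME maps `eA` (inside
  `A`, clause (C)) and `eBA` (across the twist, clause (C′G)) plus the class bookkeeping (`stA γ (out [γ])`, regularity along `stA`∕`corr`∕`stB`, composition of
  `stA`, compatibility of `corr` with the stable conjugacies); **`IsInnerTransferRel.of_isQuotientOf_of_transport`** ∕ **`IsInnerTransferExistsRel.…`** — (14.2.1)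
  and its ∃-form for `(m′, m)` from `(m′₀, m₀)`.  The archimedean organ is then pure instantiation (`eA ∕ eBA := fun _ _ h hc => ⇑(archStableCentralizerEquiv … hc h)`).
* §4 (ED. 3, append-only) the archimedean DRESS of §2 — **`IsArchInnerTransfer.of_forall_eq_smul`** ∕ **`IsArchInnerTransferExists.of_forall_eq_smul`** on the
  carriers `U(H′)(L⁺ ⊗ ℝ)`, `U(Φ₃)(L⁺ ⊗ ℝ)` with `L`, `H′` and the orbit-quotient σ-algebras as IMPLICIT binders (closed by unification at a consumer's fixed Borel families;
  the hypothesis is the LH2 skeleton's `HasCommonScalarAt` verbatim).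
NOT here: the archimedean instantiation over ★ `ArchCompatibleFamiliesG` (LH2-p01's organ (Σ)); the endoscopic analogue for (4.3.1) (line LH3).
HONEST LABEL: HC_CM is proved only modulo the printed citations (2 remaining named inputs: hLiu418 = `stmt-HodgeConjecture-24832`, h413 =
`stmt-HodgeConjecture-24833`) until rung 0 closes; this file is unconditional measure bookkeeping and proves no printed statement.

## References
* [Rogawski1990] J. D. Rogawski, *Automorphic Representations of Unitary Groups in Three Variables*, Ann. of Math. Stud. 123 (1990), §1.7 p. 6, §4.1 (4.1.1)
  p. 39, §4.3 (4.3.1) p. 43, §14.2 (14.2.1) pp. 232–233.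
* [DeitmarEchterhoff2014] A. Deitmar, S. Echterhoff, *Principles of Harmonic Analysis*, 2nd ed. (2014), Thm. 1.5.3 (invariant quotient measures).
* [Shelstad1979] D. Shelstad, *Characters and inner forms of a quasi-split group over ℝ*, Compositio Math. 39 (1979), §4 p. 20 (transport of `dt`).
-/

set_option autoImplicit false

noncomputable section

open MeasureTheory Measure Set
open Literature.MeasureTheory.Group
open scoped ENNReal NNReal

namespace Literature.NumberTheory.Automorphic

/-! ## §0 Bookkeeping: a Haar measure is cancellable; the ratio of two measures is transported by any map pushing both forward -/

section Cancel

/-- **A Haar measure is cancellable under the `ℝ≥0`-action**: on a locally compact group, `κ₁ • μ = κ₂ • μ` for a Haar measure `μ` forces `κ₁ = κ₂`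
(evaluate at a compact set with non-empty interior, of positive finite mass). [cite: DeitmarEchterhoff2014, Thm. 1.5.3] -/
theorem nnreal_eq_of_smul_eq_smul_of_isHaarMeasure {Z : Type*} [Group Z] [TopologicalSpace Z] [LocallyCompactSpace Z] [MeasurableSpace Z]
    (μ : Measure Z) [μ.IsHaarMeasure] {κ₁ κ₂ : ℝ≥0} (h : (κ₁ • μ : Measure Z) = κ₂ • μ) : κ₁ = κ₂ := by
  haveI : Nonempty Z := ⟨1⟩
  obtain ⟨K⟩ := (TopologicalSpace.PositiveCompacts.nonempty' : Nonempty (TopologicalSpace.PositiveCompacts Z))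
  have h0 : μ K ≠ 0 := (Measure.measure_pos_of_nonempty_interior μ K.interior_nonempty).ne'
  have htop : μ K ≠ ∞ := K.isCompact.measure_lt_top.ne
  have h1 := congrArg (fun m : Measure Z => m K) h
  simp only [Measure.smul_apply, ENNReal.smul_def, smul_eq_mul] at h1
  exact ENNReal.coe_inj.1 ((ENNReal.mul_left_inj h0 htop).1 h1)

/-- **The ratio of two measures is transported by any map pushing both forward**: if `e : Z₁ → Z₂` maps `s₁ ↦ s₂` and `t₁ ↦ t₂` (`Measure.map`), `t₁ = κ₁ • s₁`,
`t₂ = κ₂ • s₂`, and `s₂` is a Haar measure on the locally compact group `Z₂`, then `κ₁ = κ₂` — the shape in which the transport clauses (C), (C′), (C′G) of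
★ `ArchCompatibleFamiliesG` (`Measure.map ⇑(archStableCentralizerEquiv …) (t γ₁) = t γ₂` for BOTH systems) make the Haar ratio of two systems constant on
stable classes and equal across the inner twist ([Shelstad1979, §4 p. 20]: «the pair `dt′, ψ_x` defines a measure `dt` on `T`, independently of the choice of `x`»).
[cite: Rogawski1990, §1.7 p. 6] -/
theorem nnreal_eq_of_map_eq_of_eq_smul {Z₁ Z₂ : Type*} [MeasurableSpace Z₁] [Group Z₂] [TopologicalSpace Z₂] [LocallyCompactSpace Z₂]
    [MeasurableSpace Z₂] {e : Z₁ → Z₂} {s₁ t₁ : Measure Z₁} {s₂ t₂ : Measure Z₂} [s₂.IsHaarMeasure] {κ₁ κ₂ : ℝ≥0}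
    (hs : Measure.map e s₁ = s₂) (ht : Measure.map e t₁ = t₂) (h₁ : t₁ = κ₁ • s₁) (h₂ : t₂ = κ₂ • s₂) : κ₁ = κ₂ := by
  refine nnreal_eq_of_smul_eq_smul_of_isHaarMeasure s₂ ?_
  rw [← h₂, ← ht, h₁, Measure.map_smul, hs]

end Cancel

/-! ## §1 Two Weil-form families for the same Haar measure differ class by class by the Haar ratio of their torus measures -/

section Ratio

variable {G : Type*} [Group G] [TopologicalSpace G] [IsTopologicalGroup G] [LocallyCompactSpace G]
  [SecondCountableTopology G] [T2Space G] [MeasurableSpace G] [BorelSpace G]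
  [∀ γ : G, MeasurableSpace (G ⧸ Subgroup.centralizer ({γ} : Set G))]
  [∀ γ : G, BorelSpace (G ⧸ Subgroup.centralizer ({γ} : Set G))]

/-- **Two Weil-form families `m = dν ∕ dt`, `m₀ = dν ∕ dt₀` for the SAME Haar measure `ν` differ at every `P`-class by the Haar ratio of the torus measures**:
at a class `c` with `P (out c)`, both `t (out c)` and `t₀ (out c)` are Haar measures on the closed subgroup `Z(out c)` (★ `IsQuotientOf`), so
`t (out c) = κ • t₀ (out c)` with `κ = haarScalarFactor (t (out c)) (t₀ (out c)) > 0` (Mathlib `isMulLeftInvariant_eq_smul` on the locally compact second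
countable group `Z(out c)`), and then `m c = dν ∕ d(κ t₀) = κ⁻¹ • dν ∕ dt₀ = κ⁻¹ • m₀ c` (★ `quotientMeasure_eq_inv_smul_of_eq_smul`).  Print: «Measures `dg` and
`dg′` … are said to be compatible if `dg = c|Ω|_v` and `dg′ = c|Ω′|_v` for some constant `c`» (§1.7 p. 6) — two admissible normalisations of the torus measure
differ by a constant, and the orbital integral is linear in `dg ∕ dg_γ`. [cite: Rogawski1990, §1.7 p. 6; §4.3 (4.3.1) p. 43] [cite: DeitmarEchterhoff2014, Thm. 1.5.3] -/
theorem OrbitalMeasureFamily.IsQuotientOf.exists_eq_nnreal_smul {P : G → Prop} {ν : Measure G} [ν.IsHaarMeasure] [ν.IsMulRightInvariant]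
    {t t₀ : ∀ γ : G, Measure (Subgroup.centralizer ({γ} : Set G))} {m m₀ : OrbitalMeasureFamily G}
    (h : m.IsQuotientOf P ν t) (h₀ : m₀.IsQuotientOf P ν t₀) (c : ConjClasses G) (hc : P (Quotient.out c)) :
    ∃ κ : ℝ≥0, 0 < κ ∧ t (Quotient.out c) = κ • t₀ (Quotient.out c) ∧ m c = (κ⁻¹ : ℝ≥0) • m₀ c := by
  obtain ⟨ht, hti, hm⟩ := h c hc
  obtain ⟨ht₀, ht₀i, hm₀⟩ := h₀ c hc
  haveI hZc : IsClosed ((Subgroup.centralizer ({(Quotient.out c : G)} : Set G) : Subgroup G) : Set G) :=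
    isClosed_coe_centralizer_singleton (Quotient.out c)
  haveI : LocallyCompactSpace (Subgroup.centralizer ({(Quotient.out c : G)} : Set G)) :=
    (isClosed_coe_centralizer_singleton (Quotient.out c)).isClosedEmbedding_subtypeVal.locallyCompactSpace
  haveI : SecondCountableTopology (Subgroup.centralizer ({(Quotient.out c : G)} : Set G)) :=
    TopologicalSpace.Subtype.secondCountableTopology _
  have hκ : 0 < haarScalarFactor (t (Quotient.out c)) (t₀ (Quotient.out c)) := haarScalarFactor_pos_of_isHaarMeasure _ _
  have hst : t (Quotient.out c) = haarScalarFactor (t (Quotient.out c)) (t₀ (Quotient.out c)) • t₀ (Quotient.out c) :=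
    isMulLeftInvariant_eq_smul _ _
  refine ⟨haarScalarFactor (t (Quotient.out c)) (t₀ (Quotient.out c)), hκ, hst, ?_⟩
  rw [hm, hm₀]
  exact quotientMeasure_eq_inv_smul_of_eq_smul (Subgroup.centralizer ({(Quotient.out c : G)} : Set G)) ν
    (t₀ (Quotient.out c)) (t (Quotient.out c)) _ hκ.ne' hst

omit [TopologicalSpace G] [IsTopologicalGroup G] [LocallyCompactSpace G] [SecondCountableTopology G] [T2Space G] [MeasurableSpace G] [BorelSpace G]
  [∀ γ : G, BorelSpace (G ⧸ Subgroup.centralizer ({γ} : Set G))] in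
/-- `(κ : ℝ≥0) • μ = (κ : ℝ≥0∞) • μ` on an orbit quotient (the two scalar actions on measures agree). [cite: DeitmarEchterhoff2014, Thm. 1.5.3] -/
theorem OrbitalMeasureFamily.nnreal_smul_apply_eq_coe_smul (κ : ℝ≥0) (m : OrbitalMeasureFamily G) (c : ConjClasses G) :
    (κ • m c : Measure (G ⧸ Subgroup.centralizer ({(Quotient.out c : G)} : Set G))) = (κ : ℝ≥0∞) • m c := by
  ext s _
  rw [Measure.smul_apply, Measure.smul_apply, ENNReal.smul_def]

/-- **`ℝ≥0∞`-weight form** of `IsQuotientOf.exists_eq_nnreal_smul`: at every `P`-class, `m c = κ • m₀ c` for a weight `κ : ℝ≥0∞` with `κ ≠ 0`, `κ ≠ ⊤`,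
namely `κ = (haarScalarFactor (t (out c)) (t₀ (out c)))⁻¹`, and `t (out c) = κ⁻¹ • t₀ (out c)` — the currency of ★ `stableOrbitalIntegralRel_smul` ∕
★ `IsInnerTransferRel.pi_smul` and of §2 below. [cite: Rogawski1990, §1.7 p. 6; §4.3 (4.3.1) p. 43] [cite: DeitmarEchterhoff2014, Thm. 1.5.3] -/
theorem OrbitalMeasureFamily.IsQuotientOf.exists_eq_smul {P : G → Prop} {ν : Measure G} [ν.IsHaarMeasure] [ν.IsMulRightInvariant]
    {t t₀ : ∀ γ : G, Measure (Subgroup.centralizer ({γ} : Set G))} {m m₀ : OrbitalMeasureFamily G}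
    (h : m.IsQuotientOf P ν t) (h₀ : m₀.IsQuotientOf P ν t₀) (c : ConjClasses G) (hc : P (Quotient.out c)) :
    ∃ κ : ℝ≥0, 0 < κ ∧ t (Quotient.out c) = κ • t₀ (Quotient.out c) ∧ m c = ((κ⁻¹ : ℝ≥0) : ℝ≥0∞) • m₀ c := by
  obtain ⟨κ, hκ, hst, hm⟩ := h.exists_eq_nnreal_smul h₀ c hc
  exact ⟨κ, hκ, hst, by rw [hm, OrbitalMeasureFamily.nnreal_smul_apply_eq_coe_smul]⟩

end Ratio

end Literature.NumberTheory.Automorphic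

/-! ## §2 `Φ^st` and (14.2.1) under class-by-class weights given only on the classes they read -/

namespace Literature.NumberTheory.Rogawski1990

open Literature.NumberTheory.Automorphic

section Abstract

variable {G : Type*} [Group G] [∀ γ : G, MeasurableSpace (G ⧸ Subgroup.centralizer ({γ} : Set G))]

/-- **`Φ^st_m(γ, f)` reads the family `m` only at the classes of the stable class of `γ`**: if `m c = m₀ c` whenever `st γ (out c)`, then
`Φ^st_m(γ, f) = Φ^st_{m₀}(γ, f)` (★ `stableOrbitalIntegralRel` is the `finsum` over exactly those classes). [cite: Rogawski1990, §4.1 (4.1.1) p. 39] -/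
theorem stableOrbitalIntegralRel_congr_measure (st : G → G → Prop) {m m₀ : OrbitalMeasureFamily G} {γ : G}
    (h : ∀ c : ConjClasses G, st γ (Quotient.out c) → m c = m₀ c) (f : G → ℂ) :
    stableOrbitalIntegralRel st m f γ = stableOrbitalIntegralRel st m₀ f γ := by
  rw [stableOrbitalIntegralRel_def, stableOrbitalIntegralRel_def]
  exact finsum_mem_congr rfl fun c hc => by rw [classOrbitalIntegral_eq, classOrbitalIntegral_eq, h c hc]

/-- **A weight given on the stable class of `γ` only comes out of `Φ^st(γ, ·)`**: if `m c = κ • m₀ c` for every class `c` with `st γ (out c)` (one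
`κ : ℝ≥0∞`, nothing asked of `m`, `m₀` at the other classes), then `Φ^st_m(γ, f) = κ.toReal · Φ^st_{m₀}(γ, f)` (★ `classOrbitalIntegral_smul_measure_eq_mul`
class by class; Mathlib `mul_finsum_mem`, no finiteness needed over `ℂ`) — the LOCAL form of ★ `stableOrbitalIntegralRel_pi_smul_of_const`.
[cite: Rogawski1990, §4.1 (4.1.1) p. 39; §1.7 p. 6] -/
theorem stableOrbitalIntegralRel_eq_mul_of_forall_eq_smul (st : G → G → Prop) {m m₀ : OrbitalMeasureFamily G} {γ : G} {κ : ℝ≥0∞}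
    (h : ∀ c : ConjClasses G, st γ (Quotient.out c) → m c = κ • m₀ c) (f : G → ℂ) :
    stableOrbitalIntegralRel st m f γ = (κ.toReal : ℂ) * stableOrbitalIntegralRel st m₀ f γ := by
  rw [stableOrbitalIntegralRel_congr_measure st (m₀ := κ • m₀) (fun c hc => by rw [h c hc, OrbitalMeasureFamily.smul_apply]) f,
    stableOrbitalIntegralRel_smul]

variable {A B : Type*} [Group A] [Group B]
  [∀ a : A, MeasurableSpace (A ⧸ Subgroup.centralizer ({a} : Set A))]
  [∀ b : B, MeasurableSpace (B ⧸ Subgroup.centralizer ({b} : Set B))]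

/-- **(14.2.1) SURVIVES A CHANGE OF SYSTEM given class by class on the classes it reads**: if `f′ → f` for `(m′₀, m₀)` and, for every regular `γ ∈ A`,
ONE weight `κ : ℝ≥0∞` satisfies `m c = κ • m₀ c` on the classes of the stable class of `γ` AND `m′ c′ = κ • m′₀ c′` on the classes of the stable class of
every `γ′ ↔ γ`, then `f′ → f` for `(m′, m)` (both stable orbital integrals acquire the factor `κ.toReal`; the vanishing branch acquires it too).  This is
★ `IsInnerTransferRel.pi_smul` with the weights read off the two systems instead of imposed, and with no hypothesis at the non-regular classes — exactly what
two Weil-form systems for the same Haar measures provide (§1 + the transport clauses). [cite: Rogawski1990, §14.2 (14.2.1) pp. 232–233; §1.7 p. 6] -/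
theorem IsInnerTransferRel.of_forall_eq_smul {corr : B → A → Prop} {stB : B → B → Prop} {stA : A → A → Prop} {regA : A → Prop}
    {m'₀ m' : OrbitalMeasureFamily B} {m₀ m : OrbitalMeasureFamily A} {f' : B → ℂ} {f : A → ℂ}
    (h : IsInnerTransferRel corr stB stA regA m'₀ m₀ f' f)
    (hκ : ∀ γ : A, regA γ → ∃ κ : ℝ≥0∞, (∀ c : ConjClasses A, stA γ (Quotient.out c) → m c = κ • m₀ c) ∧
      ∀ γ' : B, corr γ' γ → ∀ c' : ConjClasses B, stB γ' (Quotient.out c') → m' c' = κ • m'₀ c') :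
    IsInnerTransferRel corr stB stA regA m' m f' f := by
  intro γ hγ
  obtain ⟨κ, hA, hB⟩ := hκ γ hγ
  obtain ⟨h1, h2⟩ := h γ hγ
  refine ⟨fun γ' hc => ?_, fun hno => ?_⟩
  · rw [stableOrbitalIntegralRel_eq_mul_of_forall_eq_smul stA hA, stableOrbitalIntegralRel_eq_mul_of_forall_eq_smul stB (hB γ' hc), h1 γ' hc]
  · rw [stableOrbitalIntegralRel_eq_mul_of_forall_eq_smul stA hA, h2 hno, mul_zero]

/-- **The ∃-form** (★ `IsInnerTransferExistsRel`): under the same class-by-class hypothesis, every `f′ ∈ Smooth_B` that has a (14.2.1)-partner in `Smooth_A` for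
`(m′₀, m₀)` has one (the SAME `f`) for `(m′, m)`. [cite: Rogawski1990, §14.2 (14.2.1) pp. 232–233] -/
theorem IsInnerTransferExistsRel.of_forall_eq_smul {corr : B → A → Prop} {stB : B → B → Prop} {stA : A → A → Prop} {regA : A → Prop}
    {m'₀ m' : OrbitalMeasureFamily B} {m₀ m : OrbitalMeasureFamily A} {SmoothB : (B → ℂ) → Prop} {SmoothA : (A → ℂ) → Prop}
    (h : IsInnerTransferExistsRel corr stB stA regA m'₀ m₀ SmoothB SmoothA)
    (hκ : ∀ γ : A, regA γ → ∃ κ : ℝ≥0∞, (∀ c : ConjClasses A, stA γ (Quotient.out c) → m c = κ • m₀ c) ∧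
      ∀ γ' : B, corr γ' γ → ∀ c' : ConjClasses B, stB γ' (Quotient.out c') → m' c' = κ • m'₀ c') :
    IsInnerTransferExistsRel corr stB stA regA m' m SmoothB SmoothA := fun f' hf' => by
  obtain ⟨f, hf, hT⟩ := h f' hf'
  exact ⟨f, hf, hT.of_forall_eq_smul hκ⟩

end Abstract

/-! ## §3 (ED. 2) The packaged assembly: two Weil-form systems for the same Haar measures with torus measures transported along the SAME maps
give (14.2.1) for one system from (14.2.1) for the other — abstract topological groups, transport maps as PARAMETERS -/

section Assembly

variable {A B : Type*}
  [Group A] [TopologicalSpace A] [IsTopologicalGroup A] [LocallyCompactSpace A] [SecondCountableTopology A] [T2Space A]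
  [MeasurableSpace A] [BorelSpace A]
  [∀ γ : A, MeasurableSpace (A ⧸ Subgroup.centralizer ({γ} : Set A))] [∀ γ : A, BorelSpace (A ⧸ Subgroup.centralizer ({γ} : Set A))]
  [Group B] [TopologicalSpace B] [IsTopologicalGroup B] [LocallyCompactSpace B] [SecondCountableTopology B] [T2Space B]
  [MeasurableSpace B] [BorelSpace B]
  [∀ γ' : B, MeasurableSpace (B ⧸ Subgroup.centralizer ({γ'} : Set B))] [∀ γ' : B, BorelSpace (B ⧸ Subgroup.centralizer ({γ'} : Set B))]
  {corr : B → A → Prop} {stB : B → B → Prop} {stA : A → A → Prop} {regA : A → Prop} {regB : B → Prop}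
  {νA : Measure A} [νA.IsHaarMeasure] [νA.IsMulRightInvariant] {νB : Measure B} [νB.IsHaarMeasure] [νB.IsMulRightInvariant]
  {t t₀ : ∀ γ : A, Measure (Subgroup.centralizer ({γ} : Set A))} {t' t'₀ : ∀ γ' : B, Measure (Subgroup.centralizer ({γ'} : Set B))}
  {m m₀ : OrbitalMeasureFamily A} {m' m'₀ : OrbitalMeasureFamily B}

/-- **THE WEIGHT OF TWO WEIL-FORM SYSTEMS IS ONE NUMBER PER REGULAR STABLE CLASS AND ITS IMAGE** (the hypothesis `hκ` of `IsInnerTransferRel.of_forall_eq_smul`,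
DERIVED).  Data: two systems `(m′, m, t′, t)` and `(m′₀, m₀, t′₀, t₀)` in Weil form for the SAME Haar measures `νB` on `B` («`G′`») and `νA` on `A` («`G`») at
the regular classes (★ `IsQuotientOf`: (W′)(W) of ★ `ArchCompatibleFamiliesG` for both), whose torus measures are transported along the SAME maps — inside `A`
along `eA γ₁ γ₂ : Z(γ₁) → Z(γ₂)` for regular `γ₁` with `stA γ₁ γ₂` ((C) for both systems), and across the twist along `eBA γ′ γ : Z(γ′) → Z(γ)` for regular `γ′`
with `corr γ′ γ` ((C′G) for both systems); the maps are PARAMETERS (for the archimedean carriers: `⇑(archStableCentralizerEquiv …)`, whose term depends only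
on `hanis`, the correspondence and the regularity proof, hence is shared by the two systems), no measurability is asked of them.  Class bookkeeping (all
one-liners for ★ `IsStablyConj` ∕ ★ `Corresponds` ∕ ★ `IsRegularElt`): `stA γ (out [γ])`; regularity propagates along `stA`, along `corr` to `B`, and along
`stB`; `stA` composes (`stA γ δ → stA γ ε → stA δ ε`); `corr` is compatible with the two stable conjugacies.  CLAIM: for every regular `γ ∈ A` there is ONE
weight `κ : ℝ≥0∞` (namely `(haarScalarFactor (t γ_c) (t₀ γ_c))⁻¹` at `γ_c = out [γ]`) with `m c = κ • m₀ c` on every class `c` of the stable class of `γ` and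
`m′ c′ = κ • m′₀ c′` on every class `c′` of the stable class of every `γ′ ↔ γ` — §1 at each class, §0 along `eA (out [γ]) (out c)` and along
`eBA (out c′) (out [γ])`.  (Transport inside `B`, (C′), is not needed: every `B`-class is compared directly with the reference class `[γ]` across the twist.)
[cite: Rogawski1990, §1.7 p. 6; §14.2 (14.2.1) pp. 232–233] [cite: Shelstad1979, §4 p. 20] -/
theorem exists_weight_of_isQuotientOf_of_transport
    (hW : m.IsQuotientOf regA νA t) (hW₀ : m₀.IsQuotientOf regA νA t₀)
    (hW' : m'.IsQuotientOf regB νB t') (hW'₀ : m'₀.IsQuotientOf regB νB t'₀)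
    (houtA : ∀ γ : A, stA γ (Quotient.out (ConjClasses.mk γ)))
    (hregA : ∀ γ δ : A, regA γ → stA γ δ → regA δ)
    (htransA : ∀ γ δ ε : A, stA γ δ → stA γ ε → stA δ ε)
    (hregB : ∀ (γ' : B) (γ : A), regA γ → corr γ' γ → regB γ')
    (hregB' : ∀ γ' δ' : B, regB γ' → stB γ' δ' → regB δ')
    (hcorr : ∀ (γ' δ' : B) (γ δ : A), corr γ' γ → stB γ' δ' → stA γ δ → corr δ' δ)
    (eA : ∀ γ₁ γ₂ : A, regA γ₁ → stA γ₁ γ₂ → Subgroup.centralizer ({γ₁} : Set A) → Subgroup.centralizer ({γ₂} : Set A))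
    (hCA : ∀ (γ₁ γ₂ : A) (h₁ : regA γ₁) (hc : stA γ₁ γ₂), Measure.map (eA γ₁ γ₂ h₁ hc) (t γ₁) = t γ₂)
    (hCA₀ : ∀ (γ₁ γ₂ : A) (h₁ : regA γ₁) (hc : stA γ₁ γ₂), Measure.map (eA γ₁ γ₂ h₁ hc) (t₀ γ₁) = t₀ γ₂)
    (eBA : ∀ (γ' : B) (γ : A), regB γ' → corr γ' γ → Subgroup.centralizer ({γ'} : Set B) → Subgroup.centralizer ({γ} : Set A))
    (hCBA : ∀ (γ' : B) (γ : A) (h' : regB γ') (hc : corr γ' γ), Measure.map (eBA γ' γ h' hc) (t' γ') = t γ)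
    (hCBA₀ : ∀ (γ' : B) (γ : A) (h' : regB γ') (hc : corr γ' γ), Measure.map (eBA γ' γ h' hc) (t'₀ γ') = t₀ γ)
    (γ : A) (hγ : regA γ) :
    ∃ κ : ℝ≥0∞, (∀ c : ConjClasses A, stA γ (Quotient.out c) → m c = κ • m₀ c) ∧
      ∀ γ' : B, corr γ' γ → ∀ c' : ConjClasses B, stB γ' (Quotient.out c') → m' c' = κ • m'₀ c' := by
  -- the reference class `[γ]` and its weight
  have hγout : stA γ (Quotient.out (ConjClasses.mk γ)) := houtA γ
  have hreg₀ : regA (Quotient.out (ConjClasses.mk γ)) := hregA _ _ hγ hγout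
  obtain ⟨κ, -, htκ, hmκ⟩ := hW.exists_eq_smul hW₀ (ConjClasses.mk γ) hreg₀
  obtain ⟨hHaar₀, -, -⟩ := hW₀ (ConjClasses.mk γ) hreg₀
  haveI : LocallyCompactSpace (Subgroup.centralizer ({(Quotient.out (ConjClasses.mk γ) : A)} : Set A)) :=
    (isClosed_coe_centralizer_singleton (Quotient.out (ConjClasses.mk γ))).isClosedEmbedding_subtypeVal.locallyCompactSpace
  refine ⟨((κ⁻¹ : ℝ≥0) : ℝ≥0∞), fun c hc => ?_, fun γ' hcorr' c' hc' => ?_⟩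
  · -- a class `c` of the stable class of `γ`: its weight is transported from `[γ]` along `eA`
    have hregc : regA (Quotient.out c) := hregA _ _ hγ hc
    obtain ⟨κc, -, htκc, hmκc⟩ := hW.exists_eq_smul hW₀ c hregc
    obtain ⟨hHaarc, -, -⟩ := hW₀ c hregc
    haveI : LocallyCompactSpace (Subgroup.centralizer ({(Quotient.out c : A)} : Set A)) :=
      (isClosed_coe_centralizer_singleton (Quotient.out c)).isClosedEmbedding_subtypeVal.locallyCompactSpace
    have hst : stA (Quotient.out (ConjClasses.mk γ)) (Quotient.out c) := htransA _ _ _ hγout hc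
    have hκeq : κ = κc :=
      nnreal_eq_of_map_eq_of_eq_smul (hCA₀ _ _ hreg₀ hst) (hCA _ _ hreg₀ hst) htκ htκc
    rw [hmκc, ← hκeq]
  · -- a class `c′` of the stable class of `γ′ ↔ γ`: its weight is transported to `[γ]` across the twist along `eBA`
    have hregc' : regB (Quotient.out c') := hregB' _ _ (hregB _ _ hγ hcorr') hc'
    obtain ⟨κ', -, htκ', hmκ'⟩ := hW'.exists_eq_smul hW'₀ c' hregc'
    have hco : corr (Quotient.out c') (Quotient.out (ConjClasses.mk γ)) := hcorr _ _ _ _ hcorr' hc' hγout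
    have hκeq : κ' = κ :=
      nnreal_eq_of_map_eq_of_eq_smul (hCBA₀ _ _ hregc' hco) (hCBA _ _ hregc' hco) htκ' htκ
    rw [hmκ', hκeq]

/-- **(14.2.1) FOR ONE WEIL-FORM SYSTEM FROM (14.2.1) FOR ANOTHER** (same Haar measures, torus measures transported along the same maps — hypotheses as in
`exists_weight_of_isQuotientOf_of_transport`): `f′ → f` for `(m′₀, m₀)` gives `f′ → f` for `(m′, m)`, SAME functions.  This is the sentence «for every compatible
system» ⟸ «for one compatible system» of ★ `ArchInnerTransferCompatible`'s docstring in abstract form; the archimedean organ instantiates `A ∕ B` at the `arch`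
carriers, `stA ∕ stB ∕ corr` at ★ `IsStablyConj` ∕ ★ `Corresponds`, `regA ∕ regB` at ★ `IsRegularElt`, `eA ∕ eBA` at `⇑(archStableCentralizerEquiv …)`.
[cite: Rogawski1990, §14.2 (14.2.1) pp. 232–233; §1.7 p. 6] [cite: Shelstad1979, §4 p. 20, Thm. 4.1 p. 21] -/
theorem IsInnerTransferRel.of_isQuotientOf_of_transport
    (hW : m.IsQuotientOf regA νA t) (hW₀ : m₀.IsQuotientOf regA νA t₀)
    (hW' : m'.IsQuotientOf regB νB t') (hW'₀ : m'₀.IsQuotientOf regB νB t'₀)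
    (houtA : ∀ γ : A, stA γ (Quotient.out (ConjClasses.mk γ)))
    (hregA : ∀ γ δ : A, regA γ → stA γ δ → regA δ)
    (htransA : ∀ γ δ ε : A, stA γ δ → stA γ ε → stA δ ε)
    (hregB : ∀ (γ' : B) (γ : A), regA γ → corr γ' γ → regB γ')
    (hregB' : ∀ γ' δ' : B, regB γ' → stB γ' δ' → regB δ')
    (hcorr : ∀ (γ' δ' : B) (γ δ : A), corr γ' γ → stB γ' δ' → stA γ δ → corr δ' δ)
    (eA : ∀ γ₁ γ₂ : A, regA γ₁ → stA γ₁ γ₂ → Subgroup.centralizer ({γ₁} : Set A) → Subgroup.centralizer ({γ₂} : Set A))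
    (hCA : ∀ (γ₁ γ₂ : A) (h₁ : regA γ₁) (hc : stA γ₁ γ₂), Measure.map (eA γ₁ γ₂ h₁ hc) (t γ₁) = t γ₂)
    (hCA₀ : ∀ (γ₁ γ₂ : A) (h₁ : regA γ₁) (hc : stA γ₁ γ₂), Measure.map (eA γ₁ γ₂ h₁ hc) (t₀ γ₁) = t₀ γ₂)
    (eBA : ∀ (γ' : B) (γ : A), regB γ' → corr γ' γ → Subgroup.centralizer ({γ'} : Set B) → Subgroup.centralizer ({γ} : Set A))
    (hCBA : ∀ (γ' : B) (γ : A) (h' : regB γ') (hc : corr γ' γ), Measure.map (eBA γ' γ h' hc) (t' γ') = t γ)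
    (hCBA₀ : ∀ (γ' : B) (γ : A) (h' : regB γ') (hc : corr γ' γ), Measure.map (eBA γ' γ h' hc) (t'₀ γ') = t₀ γ)
    {f' : B → ℂ} {f : A → ℂ} (h : IsInnerTransferRel corr stB stA regA m'₀ m₀ f' f) :
    IsInnerTransferRel corr stB stA regA m' m f' f :=
  h.of_forall_eq_smul (exists_weight_of_isQuotientOf_of_transport hW hW₀ hW' hW'₀ houtA hregA htransA hregB hregB' hcorr
    eA hCA hCA₀ eBA hCBA hCBA₀)

/-- **The ∃-form** (★ `IsInnerTransferExistsRel`; same partner `f`, same test classes): the existence of (14.2.1)-transfers on `Smooth_B → Smooth_A` passes from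
one Weil-form system to any other with the same Haar measures and torus measures transported along the same maps. [cite: Rogawski1990, §14.2 (14.2.1) pp. 232–233]
[cite: Shelstad1979, Thm. 4.1 p. 21] -/
theorem IsInnerTransferExistsRel.of_isQuotientOf_of_transport
    (hW : m.IsQuotientOf regA νA t) (hW₀ : m₀.IsQuotientOf regA νA t₀)
    (hW' : m'.IsQuotientOf regB νB t') (hW'₀ : m'₀.IsQuotientOf regB νB t'₀)
    (houtA : ∀ γ : A, stA γ (Quotient.out (ConjClasses.mk γ)))
    (hregA : ∀ γ δ : A, regA γ → stA γ δ → regA δ)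
    (htransA : ∀ γ δ ε : A, stA γ δ → stA γ ε → stA δ ε)
    (hregB : ∀ (γ' : B) (γ : A), regA γ → corr γ' γ → regB γ')
    (hregB' : ∀ γ' δ' : B, regB γ' → stB γ' δ' → regB δ')
    (hcorr : ∀ (γ' δ' : B) (γ δ : A), corr γ' γ → stB γ' δ' → stA γ δ → corr δ' δ)
    (eA : ∀ γ₁ γ₂ : A, regA γ₁ → stA γ₁ γ₂ → Subgroup.centralizer ({γ₁} : Set A) → Subgroup.centralizer ({γ₂} : Set A))
    (hCA : ∀ (γ₁ γ₂ : A) (h₁ : regA γ₁) (hc : stA γ₁ γ₂), Measure.map (eA γ₁ γ₂ h₁ hc) (t γ₁) = t γ₂)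
    (hCA₀ : ∀ (γ₁ γ₂ : A) (h₁ : regA γ₁) (hc : stA γ₁ γ₂), Measure.map (eA γ₁ γ₂ h₁ hc) (t₀ γ₁) = t₀ γ₂)
    (eBA : ∀ (γ' : B) (γ : A), regB γ' → corr γ' γ → Subgroup.centralizer ({γ'} : Set B) → Subgroup.centralizer ({γ} : Set A))
    (hCBA : ∀ (γ' : B) (γ : A) (h' : regB γ') (hc : corr γ' γ), Measure.map (eBA γ' γ h' hc) (t' γ') = t γ)
    (hCBA₀ : ∀ (γ' : B) (γ : A) (h' : regB γ') (hc : corr γ' γ), Measure.map (eBA γ' γ h' hc) (t'₀ γ') = t₀ γ)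
    {SmoothB : (B → ℂ) → Prop} {SmoothA : (A → ℂ) → Prop} (h : IsInnerTransferExistsRel corr stB stA regA m'₀ m₀ SmoothB SmoothA) :
    IsInnerTransferExistsRel corr stB stA regA m' m SmoothB SmoothA :=
  h.of_forall_eq_smul (exists_weight_of_isQuotientOf_of_transport hW hW₀ hW' hW'₀ houtA hregA htransA hregB hregB' hcorr
    eA hCA hCA₀ eBA hCBA hCBA₀)

end Assembly

/-! ## §4 (ED. 3) The archimedean DRESS of §2 on the tree's carriers `G′_∞ = U(H′)(L⁺ ⊗ ℝ)`, `G_∞ = U(Φ₃)(L⁺ ⊗ ℝ)` (★ `IsArchInnerTransfer`,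
★ `IsArchInnerTransferExists`): σ-algebras on the orbit quotients as IMPLICIT binders, so that a consumer whose families live at the FIXED Borel σ-algebras
(★ `ArchInnerTransferCompatible`, the LH2 pay-down skeleton's organ text (R) `OrganRescale`) closes by `hT.of_forall_eq_smul hκ` with no instance search -/

section ArchDress

open NumberField

variable {L : Type} [Field L] [NumberField L] [IsCMField L] {H' : Matrix (Fin 3) (Fin 3) L}

/-- **(14.2.1) AT `∞` SURVIVES A CHANGE OF SYSTEM given class by class on the classes it reads** — the `arch` dress of `IsInnerTransferRel.of_forall_eq_smul`
(★ `IsArchInnerTransfer` is an `abbrev` of ★ `IsInnerTransferRel` at `corr := Corresponds`, `st := IsStablyConj`, `reg := IsRegularElt ∘ val`): if `a′ → a` for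
`(m′₀, m₀)` and at every regular `γ ∈ G_∞` ONE weight `κ : ℝ≥0∞` gives `m c = κ • m₀ c` on the classes of the stable class of `γ` and `m′ c′ = κ • m′₀ c′` on the
classes of the stable class of every `γ′ ↔ γ`, then `a′ → a` for `(m′, m)`.  This hypothesis is the LH2 skeleton's `HasCommonScalarAt L H′ m′₀ m′ m₀ m γ` VERBATIM,
so its organ (R) `stub_N8rescale : OrganRescale L H′` closes by `fun _ _ _ _ _ _ hT hκ => hT.of_forall_eq_smul hκ`. [cite: Rogawski1990, §14.2 (14.2.1) pp. 232–233; §1.7 p. 6] -/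
theorem IsArchInnerTransfer.of_forall_eq_smul
    {_hγ' : ∀ γ : UnitaryGroup.arch (↥(NumberField.maximalRealSubfield L)) L (IsCMField.complexConj L) 3 H',
      MeasurableSpace (UnitaryGroup.arch (↥(NumberField.maximalRealSubfield L)) L (IsCMField.complexConj L) 3 H' ⧸
        Subgroup.centralizer ({γ} : Set (UnitaryGroup.arch (↥(NumberField.maximalRealSubfield L)) L (IsCMField.complexConj L) 3 H')))}
    {_hγ : ∀ γ : UnitaryGroup.arch (↥(NumberField.maximalRealSubfield L)) L (IsCMField.complexConj L) 3
        (Matrix.of fun i j : Fin 3 => if i.val + j.val + 1 = 3 then (1 : L) else 0),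
      MeasurableSpace (UnitaryGroup.arch (↥(NumberField.maximalRealSubfield L)) L (IsCMField.complexConj L) 3
          (Matrix.of fun i j : Fin 3 => if i.val + j.val + 1 = 3 then (1 : L) else 0) ⧸
        Subgroup.centralizer ({γ} : Set (UnitaryGroup.arch (↥(NumberField.maximalRealSubfield L)) L (IsCMField.complexConj L) 3
          (Matrix.of fun i j : Fin 3 => if i.val + j.val + 1 = 3 then (1 : L) else 0))))}
    {m'₀ m' : OrbitalMeasureFamily (UnitaryGroup.arch (↥(NumberField.maximalRealSubfield L)) L (IsCMField.complexConj L) 3 H')}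
    {m₀ m : OrbitalMeasureFamily (UnitaryGroup.arch (↥(NumberField.maximalRealSubfield L)) L (IsCMField.complexConj L) 3
      (Matrix.of fun i j : Fin 3 => if i.val + j.val + 1 = 3 then (1 : L) else 0))}
    {a' : UnitaryGroup.arch (↥(NumberField.maximalRealSubfield L)) L (IsCMField.complexConj L) 3 H' → ℂ}
    {a : UnitaryGroup.arch (↥(NumberField.maximalRealSubfield L)) L (IsCMField.complexConj L) 3
      (Matrix.of fun i j : Fin 3 => if i.val + j.val + 1 = 3 then (1 : L) else 0) → ℂ}
    (hT : IsArchInnerTransfer L H' m'₀ m₀ a' a)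
    (hκ : ∀ γ : UnitaryGroup.arch (↥(NumberField.maximalRealSubfield L)) L (IsCMField.complexConj L) 3
        (Matrix.of fun i j : Fin 3 => if i.val + j.val + 1 = 3 then (1 : L) else 0),
      IsRegularElt (γ.val : GL (Fin 3) (NumberField.mixedEmbedding.mixedSpace L)) →
        ∃ κ : ℝ≥0∞,
          (∀ c : ConjClasses (UnitaryGroup.arch (↥(NumberField.maximalRealSubfield L)) L (IsCMField.complexConj L) 3
              (Matrix.of fun i j : Fin 3 => if i.val + j.val + 1 = 3 then (1 : L) else 0)),
            IsStablyConj (UnitaryGroup.conjMixed (↥(NumberField.maximalRealSubfield L)) L (IsCMField.complexConj L))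
                (UnitaryGroup.archFormOf L 3 (Matrix.of fun i j : Fin 3 => if i.val + j.val + 1 = 3 then (1 : L) else 0)) γ (Quotient.out c) →
              m c = κ • m₀ c) ∧
          ∀ γ' : UnitaryGroup.arch (↥(NumberField.maximalRealSubfield L)) L (IsCMField.complexConj L) 3 H',
            Corresponds (UnitaryGroup.conjMixed (↥(NumberField.maximalRealSubfield L)) L (IsCMField.complexConj L)) (UnitaryGroup.archFormOf L 3 H')
                (UnitaryGroup.archFormOf L 3 (Matrix.of fun i j : Fin 3 => if i.val + j.val + 1 = 3 then (1 : L) else 0)) γ' γ →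
              ∀ c' : ConjClasses (UnitaryGroup.arch (↥(NumberField.maximalRealSubfield L)) L (IsCMField.complexConj L) 3 H'),
                IsStablyConj (UnitaryGroup.conjMixed (↥(NumberField.maximalRealSubfield L)) L (IsCMField.complexConj L)) (UnitaryGroup.archFormOf L 3 H')
                    γ' (Quotient.out c') →
                  m' c' = κ • m'₀ c') :
    IsArchInnerTransfer L H' m' m a' a :=
  IsInnerTransferRel.of_forall_eq_smul hT hκ

/-- **The ∃-form at `∞`** (★ `IsArchInnerTransferExists`, any test classes `Smooth′`, `Smooth`; same partner `a`): under the same class-by-class hypothesis the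
existence of (14.2.1)-transfers passes from `(m′₀, m₀)` to `(m′, m)`. [cite: Rogawski1990, §14.2 (14.2.1) pp. 232–233] -/
theorem IsArchInnerTransferExists.of_forall_eq_smul
    {_hγ' : ∀ γ : UnitaryGroup.arch (↥(NumberField.maximalRealSubfield L)) L (IsCMField.complexConj L) 3 H',
      MeasurableSpace (UnitaryGroup.arch (↥(NumberField.maximalRealSubfield L)) L (IsCMField.complexConj L) 3 H' ⧸
        Subgroup.centralizer ({γ} : Set (UnitaryGroup.arch (↥(NumberField.maximalRealSubfield L)) L (IsCMField.complexConj L) 3 H')))}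
    {_hγ : ∀ γ : UnitaryGroup.arch (↥(NumberField.maximalRealSubfield L)) L (IsCMField.complexConj L) 3
        (Matrix.of fun i j : Fin 3 => if i.val + j.val + 1 = 3 then (1 : L) else 0),
      MeasurableSpace (UnitaryGroup.arch (↥(NumberField.maximalRealSubfield L)) L (IsCMField.complexConj L) 3
          (Matrix.of fun i j : Fin 3 => if i.val + j.val + 1 = 3 then (1 : L) else 0) ⧸
        Subgroup.centralizer ({γ} : Set (UnitaryGroup.arch (↥(NumberField.maximalRealSubfield L)) L (IsCMField.complexConj L) 3
          (Matrix.of fun i j : Fin 3 => if i.val + j.val + 1 = 3 then (1 : L) else 0))))}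
    {m'₀ m' : OrbitalMeasureFamily (UnitaryGroup.arch (↥(NumberField.maximalRealSubfield L)) L (IsCMField.complexConj L) 3 H')}
    {m₀ m : OrbitalMeasureFamily (UnitaryGroup.arch (↥(NumberField.maximalRealSubfield L)) L (IsCMField.complexConj L) 3
      (Matrix.of fun i j : Fin 3 => if i.val + j.val + 1 = 3 then (1 : L) else 0))}
    {Smooth' : (UnitaryGroup.arch (↥(NumberField.maximalRealSubfield L)) L (IsCMField.complexConj L) 3 H' → ℂ) → Prop}
    {Smooth : (UnitaryGroup.arch (↥(NumberField.maximalRealSubfield L)) L (IsCMField.complexConj L) 3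
      (Matrix.of fun i j : Fin 3 => if i.val + j.val + 1 = 3 then (1 : L) else 0) → ℂ) → Prop}
    (hT : IsArchInnerTransferExists L H' m'₀ m₀ Smooth' Smooth)
    (hκ : ∀ γ : UnitaryGroup.arch (↥(NumberField.maximalRealSubfield L)) L (IsCMField.complexConj L) 3
        (Matrix.of fun i j : Fin 3 => if i.val + j.val + 1 = 3 then (1 : L) else 0),
      IsRegularElt (γ.val : GL (Fin 3) (NumberField.mixedEmbedding.mixedSpace L)) →
        ∃ κ : ℝ≥0∞,
          (∀ c : ConjClasses (UnitaryGroup.arch (↥(NumberField.maximalRealSubfield L)) L (IsCMField.complexConj L) 3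
              (Matrix.of fun i j : Fin 3 => if i.val + j.val + 1 = 3 then (1 : L) else 0)),
            IsStablyConj (UnitaryGroup.conjMixed (↥(NumberField.maximalRealSubfield L)) L (IsCMField.complexConj L))
                (UnitaryGroup.archFormOf L 3 (Matrix.of fun i j : Fin 3 => if i.val + j.val + 1 = 3 then (1 : L) else 0)) γ (Quotient.out c) →
              m c = κ • m₀ c) ∧
          ∀ γ' : UnitaryGroup.arch (↥(NumberField.maximalRealSubfield L)) L (IsCMField.complexConj L) 3 H',
            Corresponds (UnitaryGroup.conjMixed (↥(NumberField.maximalRealSubfield L)) L (IsCMField.complexConj L)) (UnitaryGroup.archFormOf L 3 H')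
                (UnitaryGroup.archFormOf L 3 (Matrix.of fun i j : Fin 3 => if i.val + j.val + 1 = 3 then (1 : L) else 0)) γ' γ →
              ∀ c' : ConjClasses (UnitaryGroup.arch (↥(NumberField.maximalRealSubfield L)) L (IsCMField.complexConj L) 3 H'),
                IsStablyConj (UnitaryGroup.conjMixed (↥(NumberField.maximalRealSubfield L)) L (IsCMField.complexConj L)) (UnitaryGroup.archFormOf L 3 H')
                    γ' (Quotient.out c') →
                  m' c' = κ • m'₀ c') :
    IsArchInnerTransferExists L H' m' m Smooth' Smooth :=
  IsInnerTransferExistsRel.of_forall_eq_smul hT hκ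

end ArchDress

end Literature.NumberTheory.Rogawski1990

end
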